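import Summits.QuantumFields.YangMills.Theorems.UnitScaleTiltHistoryTailLaneTailIntRows
import Summits.QuantumFields.YangMills.Theorems.AlphaInputsT3ACv4ChiInt
import HarnessLib

/-!
# `UnitScaleTiltHistoryTailLaneTailV4Chi` — THE F-2b `Rows` TWIN OF ✓`UnitScaleTiltHistoryTailLaneTailChi` OVER THE ROWS RECORD `AlphaInputsT3AC.PkgCoreRows` (✓`AlphaInputsT3ACv4CoreRows`; ★★OWNER RULING g26-№14 (F-2b),
# bill v1.2 §7 P19 (THE v4 DOOR), ★alpha-2 g7 checklist (s1)–(s7)) — crux `HistoryTailL` (stmt-QuantumFields-19936), cell `ym3-torus`, width seat ym-ust-19936-w3 (g5)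

WHAT.  `UnitScaleTiltHistoryTailLaneTailChi`'s statements and proofs VERBATIM with `PkgCoreV3 ↦ PkgCoreRows` (the rows record carries the version-4 run rows `runRows : AlphaV4AC.RunAlphaV4CoreAC` —
currency-free (71) per recorded plaquette `h71` in place of the comb (67)-row — so `(q K).runCore ↦ (q K).runRows`), the χ-package `PkgAtV3Chi ↦ PkgAtV4Chi` (✓`…v4Chi`) with its interior (47)′ row ✓`PkgAtV4Chi.le_resDensity_int_ae` (✓`…v4ChiInt`, ★alpha-2 g7) and `toCore ↦ toRows`, the socket `AlphaInputsT3ACv3RecChi ↦ AlphaInputsT3ACv4RecChi` (= the text of skeleton v5p10's stub `stub_laneRecordsV4Chi`, ★★OWNER RULING g26-№14 (b)); declaration names `HistoryTailLaneTailChi.{dataIntV3_ineq47AE_of_chi, intCoreRec_of_laneRecordsChi, historyTailL_of_laneRecordsChi} ↦ HistoryTailLaneTailV4Chi.{dataIntRows_ineq47AE_of_v4chi, intCoreRecRows_of_laneRecordsV4Chi, ★★★historyTailL_of_laneRecordsV4Chi}`.  The cone thus runs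
over a FAMILY OF ROWS CORES `q : ∀ K, PkgCoreRows F 𝔠 γ hγ hγ1 K`, fed by the v3 cores (`PkgCoreV3.toRows`, by (69)–(71)) and by the v4 χ-package (`PkgAtV4Chi.toRows`).
THE ORIGINAL'S ACCOUNT (unchanged mathematics, names read with the substitutions above).  The χ-record `AlphaInputsT3AC.OfV4ChiAt F 𝔠 a₀ a₁` (★alpha-1's `AlphaInputsT3ACv3Chi`: print's lower row on print's validity family, [Balaban1985UV3] (47) p.267 with «χ·χ_k»)
instantiates the record-free interior socket `AlphaInputsT3AC.IntCoreRecRows` of `…HistoryTailIntData`: the family of data cores is `fun K ↦ (hχ.pkgAtV4Chi hc γ hγ hγ1 K).toRows`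
(its `a₁` is the given one, `pkgAtV4Chi_a₁`), and the lower a.e. row (47)′ for the INTERIOR datum `dataIntRows` is ★alpha-1's `PkgAtV4Chi.le_resDensity_int_ae` VERBATIM
(the interior indicator `𝟙[intWindowT3]` is `dataIntRows`'s `χ` by `rfl`; negation-lens pre-check N-g24-3) under the data-smallness binder `θBal ≤ a₁` of [Balaban1985Variational]
Thm 1 (8), which `…LaneTailInt.perPlaquetteHigh_int` discharges by its coupling threshold.  Hence `intCoreRecRows_of_laneRecordsV4Chi` and **`historyTailL_of_laneRecordsV4Chi`**:
19936 is PROVED modulo the χ-lane's END theorem `AlphaInputsT3ACv4RecChi` (NODE O's d = 3 (α) record with print's lower row) and nothing else.  Nothing of [Balaban1985UV3] is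
asserted. [cite: Balaban1985UV3, (5) p.256, (47) p.267, (71) p.273 and Thm 2 p.272; Balaban1985Variational, Thm 1 (8) p.279; King1986, (3.12) p.657]
HONEST FRAMING.  Bookkeeping twin (renaming + one field read); nothing of [Balaban1985UV3]'s cluster expansion or of [Balaban1985Variational] Thm 1 is proved; CONDITIONAL on
the family of rows cores exactly as the original is on its cores; the v3-typed original stays in the tree unchanged (banked); count-neutral helper toward 2′χ
(`--supports stmt-QuantumFields-19936`); registry untouched.  YM₃ on the three-torus is rung R3 of the programme, not the Clay problem: nothing here is about d = 4,
infinite volume, or a mass gap.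


-/

set_option autoImplicit false

noncomputable section

open MeasureTheory
open Literature.MathematicalPhysics.QuantumFieldTheory.Balaban1983to89
open Literature.MathematicalPhysics.QuantumFieldTheory.Balaban1983to89.T3ContinuumYM3Torus
open Literature.MathematicalPhysics.QuantumFieldTheory.Balaban1983to89.T3UnitScaleTilt (θBal)
open Literature.MathematicalPhysics.QuantumFieldTheory.Balaban1983to89.T3AlphaInputsAC
open Summit.QuantumFields.Balaban3D.Carriers (suGroupModel Hist)
open Summit.QuantumFields.Balaban3D.Proofs.Primitives (AlphaConsts)
open Summit.QuantumFields.YangMills.Theorems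

namespace Summit.QuantumFields.YangMills.Theorems.HistoryTailLaneTailV4Chi

/-- **THE INTERIOR (47)′ ROW OF THE χ-RECORD'S DATUM**: for a χ-package `p : PkgAtV4Chi F 𝔠 γ hγ hγ1 K` placed at height `K` of any family of data cores `qf` with
`qf K = p.toRows`, the interior datum `dataIntRows qf π` satisfies `Ineq47AE` at every level `j ≤ K` under `θBal ≤ p.a₁` — ★alpha-2's ✓`PkgAtV4Chi.le_resDensity_int_ae` (`…v4ChiInt`)
(the interior indicator IS the datum's `χ`, `rfl`). [cite: Balaban1985UV3, (47) p.267 and Thm 2 p.272; Balaban1985Variational, Thm 1 (8) p.279] -/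
theorem dataIntRows_ineq47AE_of_v4chi {F : T3Family} {𝔠 : AlphaConsts F.L (suGroupModel 2).N} {γ : ℝ} {hγ : 0 < γ} {hγ1 : γ ≤ (min 𝔠.gamma0 1) ^ 2}
    (qf : ∀ K, AlphaInputsT3AC.PkgCoreRows F 𝔠 γ hγ hγ1 K) (π : AlphaInputsT3AC.PolymerT3 F) (K : ℕ)
    (p : AlphaInputsT3AC.PkgAtV4Chi F 𝔠 γ hγ hγ1 K) (hp : qf K = p.toRows)
    (ha₁ : ∀ i, θBal F.L γ 𝔠.b₀ 𝔠.p₀ i ≤ p.a₁) (j : ℕ) (hj : j ≤ K) :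
    Ineq47AE (AlphaInputsT3AC.dataIntRows qf π) K j := by
  have h := p.le_resDensity_int_ae ha₁ j hj
  show ∀ᵐ W ∂fieldMeasure (F.P K) j (Matrix.specialUnitaryGroup (Fin 2) ℂ),
    Real.exp (-((qf K).T.Ecst j - (qf K).E) - (qf K).T.Rm j) *
        ({V : GaugeField (F.P K) j (Matrix.specialUnitaryGroup (Fin 2) ℂ) |
            PlaqSmall (θBal F.L γ 𝔠.b₀ 𝔠.p₀ (K - j) / max 𝔠.B₃ 1) V}.indicator (fun _ => (1 : ℝ)) W *
          Real.exp (-((qf K).T.mainT j (Hist.triv (F.P K) j) W) + (qf K).T.Pint j (Hist.triv (F.P K) j) W)) ≤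
      T3RestrictedUnitDensity.resDensity F γ K Set.univ j W
  rw [hp]
  exact h

/-- **THE χ-RECORD INSTANTIATES THE RECORD-FREE INTERIOR SOCKET**: `AlphaInputsT3ACv4RecChi L → AlphaInputsT3AC.IntCoreRecRows L` — rows cores `(pkgAtV4Chi …).toRows`, constant `a₁` by
`pkgAtV4Chi_a₁`, interior (47)′ by `dataIntRows_ineq47AE_of_v4chi`. [cite: Balaban1985UV3, (47) p.267 and Thm 2 p.272; Balaban1985Variational, Thm 1 (8) p.279] -/
theorem intCoreRecRows_of_laneRecordsV4Chi (L : ℕ) (h : Summit.QuantumFields.YangMills.Theorems.AlphaInputsT3ACv4RecChi L) :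
    AlphaInputsT3AC.IntCoreRecRows L := by
  obtain ⟨b₁, p₁, h⟩ := h
  refine ⟨b₁, p₁, fun b₀ p₀ hb hp => ?_⟩
  obtain ⟨𝔠, a₀, a₁, hcb, hcp, ha0, ha1, hw, hF⟩ := h b₀ p₀ hb hp
  refine ⟨𝔠, a₁, hcb, hcp, ha1, fun F hFL γ hγ hγ1 => ?_⟩
  subst hFL
  have hχ : AlphaInputsT3AC.OfV4ChiAt F 𝔠 a₀ a₁ := hF F rfl
  have hc : 0 < a₀ ∧ 0 < a₁ ∧ 𝔠.B₃ * a₁ ≤ a₀ := ⟨ha0, ha1, hw⟩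
  refine ⟨fun K => (hχ.pkgAtV4Chi hc γ hγ hγ1 K).toRows, fun K => hχ.pkgAtV4Chi_a₁ hc γ hγ hγ1 K, fun ha π K j hj => ?_⟩
  refine dataIntRows_ineq47AE_of_v4chi _ π K (hχ.pkgAtV4Chi hc γ hγ hγ1 K) rfl (fun i => ?_) j hj
  rw [hχ.pkgAtV4Chi_a₁ hc γ hγ hγ1 K]
  exact ha i

/-- ★★★ **`HistoryTailL ⇐ stub_laneRecordsV4Chi` ALONE — THE v4 DOOR** the successor skeleton v5p10 = {2′χ over the currency-free (71) row} composes (★★OWNER RULING g26-№14 (b)):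
`…LaneTailIntRows.historyTailL_of_intCoreRecRows` on `intCoreRecRows_of_laneRecordsV4Chi`.  The load-bearing item stmt-QuantumFields-19936 BY NAME, CONDITIONAL on the χ-lane's
version-4 END theorem `AlphaInputsT3ACv4RecChi L` for every odd `L > 1` — nothing else; nothing of [Balaban1985UV3] is proved here.
[cite: Balaban1985UV3, (5) p.256, (47) p.267 and (71) p.273; King1986, (3.12) p.657] -/
theorem historyTailL_of_laneRecordsV4Chi (hrec : ∀ L : ℕ, Odd L → 1 < L → Summit.QuantumFields.YangMills.Theorems.AlphaInputsT3ACv4RecChi L) :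
    Summit.QuantumFields.YangMills.Theses.UnitScaleTilt.HistoryTailL :=
  HistoryTailLaneTailIntRows.historyTailL_of_intCoreRecRows fun L hLo hL => intCoreRecRows_of_laneRecordsV4Chi L (hrec L hLo hL)

end Summit.QuantumFields.YangMills.Theorems.HistoryTailLaneTailV4Chi

end
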